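import Summits.HodgeConjecture.HodgeConjecture.Theorems.AnchorTransportVariationalHodgeReductions
import Literature.AlgebraicGeometry.Motives.CurveThroughTwoPointsProofs
import Literature.AlgebraicGeometry.Motives.HypersurfaceFieldPoints
import Mathlib.Topology.Connected.Clopen
import Mathlib.AlgebraicGeometry.Noetherian

/-!
# Propagation of a property of complex points along smooth curves, over a connected base

Route AnchorTransport, crux `VariationalHodge` (stmt-HodgeConjecture-1076) — the engine behind the
"idle base hypotheses" theorems (`AnchorTransportVariationalHodgeConnectedBase`), abstracted from the
crux so that every fibrewise transport argument of the route can use it. For a `ℂ`-scheme `S` locally of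
finite type and a property `P` of its complex points which PROPAGATES ALONG SMOOTH CURVES — for every
morphism `g : C ⟶ S` from a smooth irreducible affine `ℂ`-curve and complex points `a, b` of `C`,
`P (g a) → P (g b)` — :

* `forall_complexPoints_of_curves_of_irreducibleSpace` — if `S` is IRREDUCIBLE, `P` at one complex point
  gives `P` at every complex point (chain of affine opens, `forall_complexPoints_of_affineOpens`; inside
  an affine open two complex points lie on the image of a smooth irreducible affine curve — Mumford's
  lemma, the tree's theorem `Motives.mumford_smoothCurve_through_two_points_holds`, no hypothesis on the
  singularities);
* `forall_complexPoints_of_curves_of_isIrreducible_isClosed` — the same inside any irreducible closed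
  subset `Z ⊆ S` (through the reduced closed subscheme `V(𝒥_Z)`, Mathlib
  `Scheme.IdealSheafData.vanishingIdeal`; complex points lift, `AlgPoints.liftClosed`);
* `forall_complexPoints_of_curves` — if `S` is (PRE)CONNECTED, `P` at one complex point gives `P` at
  every complex point: the set of scheme points over whose closure `P` holds somewhere is locally
  constant in membership (an affine open neighbourhood is a noetherian space, `S` being locally
  noetherian, so after removing its finitely many irreducible components missing `x` every nearby point
  shares an irreducible closed subset with `x`), hence constant (Mathlib `PreconnectedSpace.induction₂'`).

In words: on a connected complex algebraic scheme any two complex points are linked by a finite chain of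
images of smooth affine curves, in the form needed for transport arguments. No definition, no named
fact, no `sorry`.

HONEST FRAMING: research route conditional on HC_CM; not a corollary; Q11.4-sentence-2 already refuted in
dim ≥ 3. Nothing here bears on `HC_CM` or proves a case of the Hodge conjecture.
-/

noncomputable section

-- every declaration of this problem lives in `Summit.HodgeConjecture.HodgeConjecture.…` (summit = sub-problem)
set_option linter.dupNamespace false

open CategoryTheory AlgebraicGeometry TopologicalSpace
open Literature.AlgebraicGeometry.Motives Literature.AlgebraicGeometry.HodgeTheory

namespace Summit.HodgeConjecture.HodgeConjecture.Theorems

/-! ### Irreducible bases -/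

/-- **Propagation along smooth curves over an IRREDUCIBLE base.** Let `S` be an irreducible `ℂ`-scheme
locally of finite type and `P` a property of complex points of `S` such that for every morphism
`g : C ⟶ S` from a smooth irreducible affine curve and all `a, b ∈ C(ℂ)`, `P (g a) → P (g b)`. Then
`P s₀ → P s` for all complex points `s₀, s`: chain through affine opens
(`forall_complexPoints_of_affineOpens`); inside an affine open `U` (irreducible, locally of finite type)
two distinct complex points lie on the image of a smooth irreducible affine curve by Mumford's lemma
(`mumford_smoothCurve_through_two_points_holds`). [cite: MumfordAV1970, §6 Lemma] -/
theorem forall_complexPoints_of_curves_of_irreducibleSpace {S : SchemeOver ℂ} [IrreducibleSpace S.left]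
    [LocallyOfFiniteType S.hom] (P : ComplexPoints S → Prop)
    (step : ∀ ⦃C : SchemeOver ℂ⦄ (g : C ⟶ S), IsAffine C.left → IrreducibleSpace C.left →
      AlgebraicGeometry.Smooth C.hom → topologicalKrullDim C.left = 1 →
      ∀ a b : ComplexPoints C, P (AlgPoints.map g a) → P (AlgPoints.map g b))
    {s₀ : ComplexPoints S} (h₀ : P s₀) (s : ComplexPoints S) : P s := by
  refine forall_complexPoints_of_affineOpens P (fun U hU a b haU hbU ha => ?_) h₀ s
  -- the affine open `U` as an irreducible affine `ℂ`-scheme locally of finite type, `ι : U ⟶ S`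
  haveI : IsOpenImmersion (openSubschemeOverι S U).left := inferInstanceAs (IsOpenImmersion U.ι)
  haveI hUaff : IsAffine (openSubschemeOver S U).left := hU
  haveI hUirr : IrreducibleSpace (openSubschemeOver S U).left := by
    change IrreducibleSpace U
    exact isIrreducible_iff_irreducibleSpace.mp ⟨⟨a.pt, haU⟩,
      (PreirreducibleSpace.isPreirreducible_univ (X := S.left)).open_subset U.isOpen
        (Set.subset_univ _)⟩
  haveI hUlft : LocallyOfFiniteType (openSubschemeOver S U).hom := by
    change LocallyOfFiniteType (U.ι ≫ S.hom)
    infer_instance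
  -- lift `a`, `b` to `U`
  have hrange : Set.range (AlgPoints.map (L := ℂ) (openSubschemeOverι S U)) = {Q | Q.pt ∈ U} := by
    rw [AlgPoints.range_map_of_isOpenImmersion_holds]
    ext Q
    change Q.pt ∈ U.ι.opensRange ↔ Q.pt ∈ U
    rw [Scheme.Opens.opensRange_ι]
  obtain ⟨a', rfl⟩ : a ∈ Set.range (AlgPoints.map (L := ℂ) (openSubschemeOverι S U)) := by
    rw [hrange]; exact haU
  obtain ⟨b', rfl⟩ : b ∈ Set.range (AlgPoints.map (L := ℂ) (openSubschemeOverι S U)) := by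
    rw [hrange]; exact hbU
  by_cases hab : a' = b'
  · exact hab ▸ ha
  -- a smooth irreducible affine curve through `a'`, `b'` (Mumford)
  obtain ⟨C, g, t₀, t, hCaff, hCirr, hCsm, hCdim, ht₀, ht⟩ :=
    mumford_smoothCurve_through_two_points_holds.of_irreducibleSpace a' b' hab
  have h := step (g ≫ openSubschemeOverι S U) hCaff hCirr hCsm hCdim t₀ t
  rw [AlgPoints.map_comp_apply, AlgPoints.map_comp_apply, ht₀, ht] at h
  exact h ha

/-! ### Irreducible closed subsets -/

/-- **Propagation along smooth curves inside an irreducible closed subset.** With `S` locally of finite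
type over `ℂ` and `P` propagating along smooth curves as above: if `Z ⊆ S` is closed and irreducible and
`P` holds at one complex point of `Z`, it holds at every complex point of `Z` — apply
`forall_complexPoints_of_curves_of_irreducibleSpace` on the reduced closed subscheme `V(𝒥_Z) ↪ S`
(irreducible, with generic point the generic point of `Z`), to which complex points of `Z` lift
(`AlgPoints.liftClosed`). [cite: MumfordAV1970, §6 Lemma] -/
theorem forall_complexPoints_of_curves_of_isIrreducible_isClosed {S : SchemeOver ℂ}
    [LocallyOfFiniteType S.hom] (P : ComplexPoints S → Prop)
    (step : ∀ ⦃C : SchemeOver ℂ⦄ (g : C ⟶ S), IsAffine C.left → IrreducibleSpace C.left →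
      AlgebraicGeometry.Smooth C.hom → topologicalKrullDim C.left = 1 →
      ∀ a b : ComplexPoints C, P (AlgPoints.map g a) → P (AlgPoints.map g b))
    (Z : Set S.left) (hZc : IsClosed Z) (hZi : IsIrreducible Z) {w t : ComplexPoints S}
    (hw : w.pt ∈ Z) (ht : t.pt ∈ Z) (hPw : P w) : P t := by
  -- the reduced closed subscheme `Y = V(𝒥_Z)` of `S`, `ι : Y ⟶ S`, with `range ι = Z`
  let Zc : Closeds S.left := ⟨Z, hZc⟩
  let I : S.left.IdealSheafData := Scheme.IdealSheafData.vanishingIdeal Zc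
  let Y : SchemeOver ℂ := Over.mk (I.subschemeι ≫ S.hom)
  let ι : Y ⟶ S := Over.homMk I.subschemeι rfl
  have hrange : Set.range ι.left.base = Z := by
    change Set.range I.subschemeι.base = Z
    rw [Scheme.IdealSheafData.range_subschemeι, Scheme.IdealSheafData.coe_support_vanishingIdeal]
    rfl
  haveI : IsClosedImmersion ι.left := inferInstanceAs (IsClosedImmersion I.subschemeι)
  haveI : LocallyOfFiniteType Y.hom := by
    change LocallyOfFiniteType (I.subschemeι ≫ S.hom)
    infer_instance
  -- `Y` is irreducible: its point over the generic point of `Z` is a generic point of `Y`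
  obtain ⟨y₀, hy₀⟩ : hZi.genericPoint ∈ Set.range ι.left.base := by
    rw [hrange]
    exact (hZi.isGenericPoint_genericPoint hZc).mem
  have hcl : closure ({y₀} : Set Y.left) = Set.univ := by
    rw [ι.left.isClosedEmbedding.isInducing.closure_eq_preimage_closure_image, Set.image_singleton,
      hy₀, hZi.closure_genericPoint hZc, ← hrange, Set.preimage_range]
  haveI hYirr : IrreducibleSpace Y.left :=
    (irreducibleSpace_def _).2 (IsGenericPoint.isIrreducible (S := Set.univ) hcl)
  -- lift `w`, `t` to `Y` and propagate there, for the property `P ∘ ι`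
  have hw' : w.pt ∈ Set.range ι.left := by rw [hrange]; exact hw
  have ht' : t.pt ∈ Set.range ι.left := by rw [hrange]; exact ht
  have key := forall_complexPoints_of_curves_of_irreducibleSpace (S := Y)
    (fun y => P (AlgPoints.map ι y))
    (fun C g hC hirr hsm hdim a b h => by
      have h' := step (g ≫ ι) hC hirr hsm hdim a b
      rw [AlgPoints.map_comp_apply, AlgPoints.map_comp_apply] at h'
      exact h' h)
    (s₀ := w.liftClosed ι hw') (by rw [AlgPoints.map_liftClosed]; exact hPw) (t.liftClosed ι ht')
  rwa [AlgPoints.map_liftClosed] at key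

/-! ### Connected bases -/

/-- **Propagation along smooth curves over a CONNECTED base.** Let `S` be a (pre)connected `ℂ`-scheme
locally of finite type and `P` a property of its complex points propagating along smooth curves (for every
`g : C ⟶ S` from a smooth irreducible affine curve, `P (g a) → P (g b)`). Then `P s₀ → P s` for all
complex points. Let `G ⊆ S` be the set of scheme points `x` such that `P` holds at some complex point of
`closure {x}`. By `forall_complexPoints_of_curves_of_isIrreducible_isClosed`, membership in `G` passes
between two points of a common irreducible closed subset; an affine open neighbourhood of `x` is a
noetherian space (`S` is locally noetherian), so off its finitely many irreducible components missing `x`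
every point shares an irreducible closed subset with `x`: membership in `G` is locally constant, hence
constant on the preconnected `S` (Mathlib `PreconnectedSpace.induction₂'`); `pt s₀ ∈ G`, and one more
propagation inside `closure {pt s}` reaches `s`. [cite: MumfordAV1970, §6 Lemma] -/
theorem forall_complexPoints_of_curves {S : SchemeOver ℂ} [PreconnectedSpace S.left]
    [LocallyOfFiniteType S.hom] (P : ComplexPoints S → Prop)
    (step : ∀ ⦃C : SchemeOver ℂ⦄ (g : C ⟶ S), IsAffine C.left → IrreducibleSpace C.left →
      AlgebraicGeometry.Smooth C.hom → topologicalKrullDim C.left = 1 →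
      ∀ a b : ComplexPoints C, P (AlgPoints.map g a) → P (AlgPoints.map g b))
    {s₀ : ComplexPoints S} (h₀ : P s₀) (s : ComplexPoints S) : P s := by
  haveI : JacobsonSpace S.left := LocallyOfFiniteType.jacobsonSpace S.hom
  haveI : IsLocallyNoetherian S.left := LocallyOfFiniteType.isLocallyNoetherian S.hom
  -- the set `G` of scheme points over whose closure `P` holds somewhere
  let G : Set S.left := {x | ∃ c : ComplexPoints S, c.pt ∈ closure ({x} : Set S.left) ∧ P c}
  -- every `closure {x}` carries a complex point (Jacobson)
  have hpt : ∀ x : S.left, ∃ c : ComplexPoints S, c.pt ∈ closure ({x} : Set S.left) := fun x => by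
    obtain ⟨y, hy, hyc⟩ := nonempty_inter_closedPoints
      (⟨x, subset_closure (Set.mem_singleton x)⟩ : (closure ({x} : Set S.left)).Nonempty)
      isClosed_closure.isLocallyClosed
    obtain ⟨c, rfl⟩ := EsnaultLevineViehweg.exists_algPoints_pt_eq (X := S) (k := ℂ) hyc
    exact ⟨c, hy⟩
  -- membership in `G` passes between points of a common irreducible closed subset
  have hZ : ∀ Z : Set S.left, IsClosed Z → IsIrreducible Z → ∀ x y : S.left, x ∈ Z → y ∈ Z →
      x ∈ G → y ∈ G := by
    rintro Z hZc hZi x y hx hy ⟨c, hc, hcg⟩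
    obtain ⟨d, hd⟩ := hpt y
    have hcZ : c.pt ∈ Z := (hZc.closure_subset_iff.2 (Set.singleton_subset_iff.2 hx)) hc
    have hdZ : d.pt ∈ Z := (hZc.closure_subset_iff.2 (Set.singleton_subset_iff.2 hy)) hd
    exact ⟨d, hd, forall_complexPoints_of_curves_of_isIrreducible_isClosed P step Z hZc hZi hcZ hdZ hcg⟩
  -- membership in `G` is locally constant
  have hloc : ∀ x : S.left, ∀ᶠ y in nhds x, (x ∈ G ↔ y ∈ G) := by
    intro x
    obtain ⟨U, hU, hxU, -⟩ := exists_isAffineOpen_mem_and_subset (U := ⊤) (x := x) trivial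
    haveI : IsNoetherianRing Γ(S.left, U) := IsLocallyNoetherian.component_noetherian ⟨U, hU⟩
    haveI : NoetherianSpace U := noetherianSpace_of_isAffineOpen U hU
    -- the irreducible components of `U` not through `x`: a closed subset of `U` missing `x`
    let T : Set (Set U) := {C | C ∈ irreducibleComponents U ∧ (⟨x, hxU⟩ : U) ∉ C}
    have hTfin : T.Finite := NoetherianSpace.finite_irreducibleComponents.subset fun C hC => hC.1
    have hFc : IsClosed (⋃ C ∈ T, C) :=
      hTfin.isClosed_biUnion fun C hC => isClosed_of_mem_irreducibleComponents C hC.1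
    have hxF : (⟨x, hxU⟩ : U) ∉ ⋃ C ∈ T, C := by
      intro hx
      obtain ⟨C, hC, hxC⟩ := Set.mem_iUnion₂.1 hx
      exact hC.2 hxC
    have hVx : (Subtype.val '' (⋃ C ∈ T, C)ᶜ : Set S.left) ∈ nhds x :=
      (U.isOpen.isOpenMap_subtype_val _ hFc.isOpen_compl).mem_nhds ⟨⟨x, hxU⟩, hxF, rfl⟩
    filter_upwards [hVx]
    rintro _ ⟨⟨y, hyU⟩, hyF, rfl⟩
    -- the irreducible component of `y` in `U` passes through `x`
    have hxC : (⟨x, hxU⟩ : U) ∈ irreducibleComponent (⟨y, hyU⟩ : U) := by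
      by_contra hxC
      exact hyF (Set.mem_iUnion₂.2 ⟨irreducibleComponent (⟨y, hyU⟩ : U),
        ⟨irreducibleComponent_mem_irreducibleComponents _, hxC⟩, mem_irreducibleComponent⟩)
    -- its closure in `S` is an irreducible closed subset through `x` and `y`
    have hZi : IsIrreducible (closure (Subtype.val '' irreducibleComponent (⟨y, hyU⟩ : U))) :=
      (isIrreducible_irreducibleComponent.image _ continuous_subtype_val.continuousOn).closure
    have hxZ : x ∈ closure (Subtype.val '' irreducibleComponent (⟨y, hyU⟩ : U)) :=
      subset_closure ⟨_, hxC, rfl⟩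
    have hyZ : y ∈ closure (Subtype.val '' irreducibleComponent (⟨y, hyU⟩ : U)) :=
      subset_closure ⟨_, mem_irreducibleComponent, rfl⟩
    exact ⟨hZ _ isClosed_closure hZi x y hxZ hyZ, hZ _ isClosed_closure hZi y x hyZ hxZ⟩
  -- hence constant on the preconnected base
  have hall : ∀ x y : S.left, (x ∈ G ↔ y ∈ G) :=
    PreconnectedSpace.induction₂' (fun x y => (x ∈ G ↔ y ∈ G))
      (fun x => by
        filter_upwards [hloc x] with y hy
        exact ⟨hy, hy.symm⟩)
      ⟨fun _ _ _ h₁ h₂ => h₁.trans h₂⟩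
  -- `pt s₀ ∈ G`; conclude at `s` inside the irreducible closed set `closure {pt s}`
  obtain ⟨c, hc, hcg⟩ := (hall s₀.pt s.pt).1 ⟨s₀, subset_closure (Set.mem_singleton _), h₀⟩
  exact forall_complexPoints_of_curves_of_isIrreducible_isClosed P step (closure {s.pt})
    isClosed_closure isIrreducible_singleton.closure hc (subset_closure (Set.mem_singleton _)) hcg

/-- **Symmetric form**: if `P` is carried both ways along smooth curves (`P (g a) ↔ P (g b)`), then over a
connected base locally of finite type `P` takes the same value at all complex points.
[cite: MumfordAV1970, §6 Lemma] -/
theorem complexPoints_iff_of_curves {S : SchemeOver ℂ} [PreconnectedSpace S.left]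
    [LocallyOfFiniteType S.hom] (P : ComplexPoints S → Prop)
    (step : ∀ ⦃C : SchemeOver ℂ⦄ (g : C ⟶ S), IsAffine C.left → IrreducibleSpace C.left →
      AlgebraicGeometry.Smooth C.hom → topologicalKrullDim C.left = 1 →
      ∀ a b : ComplexPoints C, P (AlgPoints.map g a) → P (AlgPoints.map g b))
    (s₀ s : ComplexPoints S) : P s₀ ↔ P s :=
  ⟨fun h => forall_complexPoints_of_curves P step h s, fun h => forall_complexPoints_of_curves P step h s₀⟩

end Summit.HodgeConjecture.HodgeConjecture.Theorems

end
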